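import Literature.AnabelianGeometry.EtaleTheta.Discharge.Sec3Cor38CriterionCoord
import Literature.AnabelianGeometry.EtaleTheta.Discharge.Sec3Prop34CnstOfRlfRFinite
import HarnessLib

/-!
# [EtTh] Def 3.6 (ii) / Cor 3.8: the side condition `hQ` ("every `Φ(W)^pf_𝔮` is `ℚ`-monoprime") DERIVED
# from the primes of `Φ₀(Y)` and the rational support of `Φ ⊆ Φ₀^Λ`, `Λ ∈ {ℤ, ℚ}`

Proof-only companion (theorems only, no `def`) in the series `Discharge/Sec3*.lean`, cell abc-iut, sub-DAG
`plan/L2/SUBDAG-EtTh-Cor38.md` row C38-L05 (GAP-LEDGER G-w4d084-3: the binder `hQ` of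
`TemperedFrobenioid.bsFldPreStepLimitCriterion_of_coord'`, `Sec3Cor38CriterionCoord.lean`).
S. Mochizuki, *The étale theta function …*, Publ. RIMS **45** (2009) [EtTh], §3: Remark 3.3.1 p.73 (PDF) —
"the set of primes of `Φ₀(Y^log)` is in natural bijective correspondence with the set of `Gal`-orbits of prime
log-divisors", each `M_𝔭 ≅ ℤ_{≥0}` (a monoid of effective `ℤ`-divisors); Def. 3.6 (i) p.76 — `Φ₀^ℤ = Φ₀`,
`Φ₀^ℚ = Φ₀^pf`, `Φ₀^ℝ = Φ₀^rlf`; Def. 3.6 (ii) pp.76–77 — `Φ ⊆ Φ^{ℝ-log} := Φ₀^ℝ|_D` "a … subfunctor in monoids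
which determines a perf-factorial divisorial monoid on `D`" [cite: MochizukiEtTh2009, Def 3.6 p.76]; and
S. Mochizuki, *The geometry of Frobenioids I* [FrdI], §0 p.10 (`Λ`-monoprime monoids), Def. 2.4 (i) p.47
(perf-factorial monoids, `M^pf ↪ ∏_𝔮 M^rlf_𝔮`) [cite: MochizukiFrdI2008, Def. 2.4(i) p.47].

WHAT IS PROVED.  The typed interface `TemperedFrobenioid` leaves the monoid type of the divisor monoid `Φ(W)`
free (its primes may be of type `ℝ`), so the consumers of row C38-L05 carry `hQ` BY NAME (census
`CENSUS-Sec3-interface-binders.md`, row hQ: "NOT derivable … automatic for `Λ ∈ {ℤ, ℚ}` integral data").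
This file proves the "automatic" half as a theorem of the tree vocabulary, from data ONE LEVEL DOWN:

* (hZQ) every prime of `Φ₀(Y_W)` is a `ℤ`- or a `ℚ`-prime (print: Remark 3.3.1), and
* (hsat) `Φ(W)` lies in the `ℚ`-saturation of the image of `Φ₀(Y_W)` in `Φ^{ℝ-log}(W) = Φ₀^ℝ(Y_W)`:
  every `x ∈ Φ(W)` has some power `x^N`, `N ≥ 1`, in the image of `Φ₀(Y_W) → Φ₀^ℝ(Y_W)` (print: for monoid
  type `Λ ∈ {ℤ, ℚ}` the divisor monoid is cut out of `Φ₀^Λ|_D`, `Φ₀^ℤ = Φ₀ ⊆ Φ₀^ℚ = Φ₀^pf`; e.g. Example 3.9,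
  where `Φ := ℕ^{-1}·(image of Φ₀)`),

imply `hQ` at `W`: every localized perfection `Φ(W)^pf_𝔮` is `ℚ`-monoprime
(`TemperedFrobenioid.isQMonoprime_pfAt_divisorMonoid_of_ratSupport`), whence row C38-L05 with `hQ` replaced
by (hZQ, hsat) (`TemperedFrobenioid.bsFldPreStepLimitCriterion_of_ratSupport`).

MECHANISM (abc-iut-w4-d084's `√2` argument of `Sec3Cor38CriterionCoord.not_isRMonoprime_bsFld`, run one level
down).  The core is a vocabulary-free lemma: a commutative monoid `P` with an injective homomorphism
`κ : P → ∏_i ℝ_{≥0}` all of whose coordinates take values in `c_i · ℚ_{≥0}` (`c_i ≠ 0`) receives NO injective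
homomorphism from `ℝ_{≥0}` (`not_injective_of_ratCoord`: an additive map `ℝ_{≥0} → ℝ_{≥0}` is a homothety,
`Frobenioids.addMonoidHom_nnreal_apply`, so at a coordinate where `1 ↦ c·q₁ ≠ 0` the image of `√2` would be
`c·q₁·√2 ∈ c·ℚ_{≥0}`); hence no monoid embedding into `P` has an `ℝ`-monoprime source, so a perf-factorial
monoid embedding into `P` has only `ℤ`- or `ℚ`-primes and `ℚ`-monoprime localized perfections
(`isQMonoprime_pfAt_of_embedding`).  `P := Φ₀(Y)^pf` carries such coordinates when every `Φ₀(Y)^pf_𝔮` is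
`ℚ`-monoprime (`Cor38Coord.exists_pfCoord`, [FrdI] Def. 2.4 (i)), which (hZQ) gives
(`RealifiedDivisorMonoids.Prop34Cnst.isQMonoprime_pfAt_of_forall`, p428518); (hsat) and the injectivity of
`Φ₀(Y)^pf → Φ₀(Y)^rlf` produce the embedding `Φ(W) ↪ Φ₀(Y)^pf`.
HONEST FRAMING: refereed pre-IUT material ([EtTh] §3 / [FrdI] §0, §2); nothing here bears on [IUTchIII]
Cor. 3.12; no statement of print is strengthened — (hsat) is print's situation for `Λ ∈ {ℤ, ℚ}` and is NOT
derivable from the typed `TemperedFrobenioid` (whose `Φ ⊆ Φ₀^ℝ|_D` may contain `ℝ`-lines); typed ≠ proved.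
Seat abc-iut-w5-d130 (gen 5), row «hQ-FROM-Φ₀» (STATUS 2026-08-26T08:32:52Z).
-/

noncomputable section

namespace Literature.AnabelianGeometry.EtaleTheta

open CategoryTheory Opposite Function NNReal Literature.AlgebraicGeometry.Frobenioids

universe u₀ v₀ u v w

/-! ### §1 The core: a monoid with rational coordinates receives no embedding of `ℝ_{≥0}` -/

namespace HQRatCoord

/-- **No injective homomorphism `ℝ_{≥0} → ∏_i ℝ_{≥0}` has all its coordinates valued in `c_i · ℚ_{≥0}`.**
Each coordinate `t ↦ (φ t)_i` is additive `ℝ_{≥0} → ℝ_{≥0}`, hence the homothety `t ↦ (φ 1)_i · t`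
([FrdI] §0 p.10: additive maps out of `ℝ_{≥0}`); injectivity gives a coordinate `i₀` with `(φ 1)_{i₀} ≠ 0`, and
there `(φ √2)_{i₀} / (φ 1)_{i₀} = √2` would be rational. [cite: MochizukiFrdI2008, §0 p.10] -/
theorem not_injective_of_ratCoord {I : Type*} (φ : Multiplicative ℝ≥0 →* (I → Multiplicative ℝ≥0))
    (hrat : ∀ i, ∃ c : ℝ≥0, c ≠ 0 ∧ ∀ t : Multiplicative ℝ≥0, ∃ q : ℚ≥0,
      Multiplicative.toAdd (φ t i) = c * (q : ℝ≥0)) :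
    ¬ Injective φ := by
  intro hinj
  -- the additive coordinates `f i : ℝ≥0 →+ ℝ≥0`, `f i t = toAdd (φ (ofAdd t) i)`
  let f : I → (ℝ≥0 →+ ℝ≥0) := fun i =>
    AddMonoidHom.toMultiplicative.symm ((Pi.evalMonoidHom (fun _ => Multiplicative ℝ≥0) i).comp φ)
  have hf : ∀ i (t : ℝ≥0), f i t = Multiplicative.toAdd (φ (Multiplicative.ofAdd t) i) := fun _ _ => rfl
  -- some coordinate of `φ 1` is nonzero
  have h1 : ∃ i₀, f i₀ 1 ≠ 0 := by
    by_contra hall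
    have hφ1 : φ (Multiplicative.ofAdd 1) = 1 := by
      funext i
      have h0 : f i 1 = 0 := not_not.mp (not_exists.mp hall i)
      rw [hf] at h0
      exact Multiplicative.toAdd.injective (by rw [h0, Pi.one_apply, toAdd_one])
    have h01 : Multiplicative.ofAdd (1 : ℝ≥0) = Multiplicative.ofAdd 0 :=
      hinj (by rw [hφ1, ofAdd_zero, map_one])
    exact one_ne_zero (Multiplicative.ofAdd.injective h01)
  obtain ⟨i₀, hi₀⟩ := h1
  obtain ⟨c, hc, hq⟩ := hrat i₀
  obtain ⟨q₁, hq₁⟩ := hq (Multiplicative.ofAdd 1)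
  rw [← hf] at hq₁
  have hq₁0 : ((q₁ : ℚ≥0) : ℝ≥0) ≠ 0 := by
    intro h
    exact hi₀ (by rw [hq₁, h, mul_zero])
  let t : ℝ≥0 := ⟨Real.sqrt 2, Real.sqrt_nonneg 2⟩
  obtain ⟨q, hqt⟩ := hq (Multiplicative.ofAdd t)
  rw [← hf, addMonoidHom_nnreal_apply (f i₀) t, hq₁, mul_assoc] at hqt
  -- `c * (q₁ * t) = c * q`, so `t = q / q₁` is rational
  have ht : t = ((q / q₁ : ℚ≥0) : ℝ≥0) := by
    rw [NNRat.cast_div, eq_div_iff hq₁0, mul_comm]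
    exact mul_left_cancel₀ hc hqt
  refine irrational_sqrt_two ⟨((q / q₁ : ℚ≥0) : ℚ), ?_⟩
  have ht' : ((t : ℝ≥0) : ℝ) = Real.sqrt 2 := rfl
  rw [← ht', ht]
  push_cast
  rfl

variable {S : Type*} {P : Type*} [CommMonoid S] [CommMonoid P] {I : Type*}

/-- **A monoid that embeds into a monoid with rational coordinates is not `ℝ`-monoprime.**
[cite: MochizukiFrdI2008, §0 p.10] -/
theorem not_isRMonoprime_of_embedding (κ : P →* (I → Multiplicative ℝ≥0)) (hκ : Injective κ)
    (hrat : ∀ i, ∃ c : ℝ≥0, c ≠ 0 ∧ ∀ a : P, ∃ q : ℚ≥0, Multiplicative.toAdd (κ a i) = c * (q : ℝ≥0))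
    (j : S →* P) (hj : Injective j) : ¬ IsRMonoprime S := by
  rintro ⟨⟨e⟩⟩
  refine not_injective_of_ratCoord ((κ.comp j).comp e.symm.toMonoidHom) (fun i => ?_)
    (hκ.comp (hj.comp e.symm.injective))
  obtain ⟨c, hc, hq⟩ := hrat i
  exact ⟨c, hc, fun t => hq (j (e.symm t))⟩

/-- **The primes of a perf-factorial monoid embedding into a monoid with rational coordinates are `ℤ`- or
`ℚ`-primes** (each `S_𝔭` is monoprime, [FrdI] Def. 2.4 (i)(b), and not of type `ℝ`).
[cite: MochizukiFrdI2008, Def. 2.4(i) p.47] -/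
theorem isZQMonoprime_primes_of_embedding (hS : IsPerfFactorial S) (κ : P →* (I → Multiplicative ℝ≥0))
    (hκ : Injective κ)
    (hrat : ∀ i, ∃ c : ℝ≥0, c ≠ 0 ∧ ∀ a : P, ∃ q : ℚ≥0, Multiplicative.toAdd (κ a i) = c * (q : ℝ≥0))
    (j : S →* P) (hj : Injective j) (𝔭 : Primes S) :
    IsZMonoprime ↥𝔭.submonoid ∨ IsQMonoprime ↥𝔭.submonoid := by
  rcases hS.isMonoprime 𝔭 with hZ | hQ | hR
  · exact Or.inl hZ
  · exact Or.inr hQ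
  · exact absurd hR (not_isRMonoprime_of_embedding κ hκ hrat (j.comp 𝔭.submonoid.subtype)
      (hj.comp Subtype.val_injective))

/-- **Every localized perfection `S^pf_𝔮` of a perf-factorial monoid embedding into a monoid with rational
coordinates is `ℚ`-monoprime** (`S^pf_𝔮 ≅ (S_𝔭)^pf`, [FrdI] §0 p.12, and `(ℤ_{≥0})^pf ≅ ℚ_{≥0}`).
[cite: MochizukiFrdI2008, Def. 2.4(i) p.47] -/
theorem isQMonoprime_pfAt_of_embedding (hS : IsPerfFactorial S) (κ : P →* (I → Multiplicative ℝ≥0))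
    (hκ : Injective κ)
    (hrat : ∀ i, ∃ c : ℝ≥0, c ≠ 0 ∧ ∀ a : P, ∃ q : ℚ≥0, Multiplicative.toAdd (κ a i) = c * (q : ℝ≥0))
    (j : S →* P) (hj : Injective j) (𝔮 : Primes (Perfection S)) : IsQMonoprime (PfAt S 𝔮) :=
  RealifiedDivisorMonoids.Prop34Cnst.isQMonoprime_pfAt_of_forall hS.isDivisorial.isSharp
    (isZQMonoprime_primes_of_embedding hS κ hκ hrat j hj) 𝔮

end HQRatCoord

/-! ### §2 Embeddings into the perfection `M₀^pf` of a monoid with `ℤ`- or `ℚ`-primes -/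

namespace HQRatCoord

variable {M₀ : Type w} {S : Type w} [CommMonoid M₀] [CommMonoid S]

/-- **`hQ` is inherited along embeddings into `M₀^pf`**: if `M₀` is perf-factorial with `ℚ`-monoprime localized
perfections `M₀^pf_𝔮` (its coordinates `M₀^pf ↪ ∏_𝔮 M₀^rlf_𝔮 ≅ ∏_𝔮 ℝ_{≥0}` are then rational,
`Cor38Coord.exists_pfCoord`), every perf-factorial monoid `S` embedding into `M₀^pf` has `ℚ`-monoprime
localized perfections. [cite: MochizukiFrdI2008, Def. 2.4(i) p.47] -/
theorem isQMonoprime_pfAt_of_embedding_perfection (h₀ : IsPerfFactorial M₀)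
    (hQ₀ : ∀ 𝔮 : Primes (Perfection M₀), IsQMonoprime (PfAt M₀ 𝔮)) (hS : IsPerfFactorial S)
    (j : S →* Perfection M₀) (hj : Injective j) (𝔮 : Primes (Perfection S)) : IsQMonoprime (PfAt S 𝔮) := by
  obtain ⟨κ, hκ, -, hrat⟩ := Cor38Coord.exists_pfCoord h₀
  exact isQMonoprime_pfAt_of_embedding hS κ hκ (fun 𝔮' => hrat 𝔮' (hQ₀ 𝔮')) j hj 𝔮

/-- The same from print's form of the hypothesis on `M₀`: every `M₀,𝔭` is `ℤ`-monoprime (or `ℚ`-monoprime)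
([EtTh] Remark 3.3.1: `Φ₀(Y)_𝔭 ≅ ℤ_{≥0}`). [cite: MochizukiEtTh2009, Rmk 3.3.1 p.73] -/
theorem isQMonoprime_pfAt_of_embedding_perfection' (h₀ : IsPerfFactorial M₀)
    (hZQ : ∀ 𝔭 : Primes M₀, IsZMonoprime ↥𝔭.submonoid ∨ IsQMonoprime ↥𝔭.submonoid) (hS : IsPerfFactorial S)
    (j : S →* Perfection M₀) (hj : Injective j) (𝔮 : Primes (Perfection S)) : IsQMonoprime (PfAt S 𝔮) :=
  isQMonoprime_pfAt_of_embedding_perfection h₀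
    (RealifiedDivisorMonoids.Prop34Cnst.isQMonoprime_pfAt_of_forall h₀.isDivisorial.isSharp hZQ) hS j hj 𝔮

/-! ### §3 Submonoids of the realification `M₀^rlf` with rational support -/

/-- `N`-th powers are injective on the realification `M₀^rlf ⊆ ∏_𝔮 M₀^rlf_𝔮` (each factor
`M^pf_𝔮 ⊗ ℝ_{≥0}` is uniquely divisible). [cite: MochizukiFrdI2008, Def. 2.4(i) p.48] -/
theorem rlf_pow_injective (h₀ : IsPerfFactorial M₀) {N : ℕ} (hN : 0 < N) :
    Injective fun x : h₀.Rlf => x ^ N := by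
  intro x y hxy
  apply Subtype.ext
  funext 𝔮
  have h := congrArg (fun z : h₀.Rlf => (z : RlfFactor M₀) 𝔮) hxy
  simp only [SubmonoidClass.coe_pow, Pi.pow_apply] at h
  exact Realification.pow_injective hN h

/-- **From rational support to an embedding into `M₀^pf`.**  If `ι : S ↪ M₀^rlf` is an injective homomorphism
such that every `ι x` has a power `(ι x)^N`, `N ≥ 1`, in the image of `M₀ → M₀^rlf`, then `S` embeds into
`M₀^pf` compatibly with `M₀^pf ↪ M₀^rlf` (the factorization homomorphism is injective, [FrdI] Def. 2.4 (i)(c),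
and `M₀^rlf` is uniquely divisible). [cite: MochizukiFrdI2008, Def. 2.4(i) p.48] -/
theorem exists_embedding_perfection_of_ratSupport (h₀ : IsPerfFactorial M₀) (ι : S →* h₀.Rlf)
    (hι : Injective ι)
    (hsat : ∀ x : S, ∃ (N : ℕ+) (d : M₀), ι x ^ (N : ℕ) = h₀.toRealification (Perfection.of M₀ d)) :
    ∃ j : S →* Perfection M₀, Injective j ∧ ∀ x : S, h₀.toRealification (j x) = ι x := by
  have hsat' : ∀ x : S, ∃ a : Perfection M₀, h₀.toRealification a = ι x := by
    intro x
    obtain ⟨N, d, hd⟩ := hsat x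
    refine ⟨Perfection.mk d N, rlf_pow_injective h₀ N.pos ?_⟩
    change h₀.toRealification (Perfection.mk d N) ^ (N : ℕ) = ι x ^ (N : ℕ)
    rw [← map_pow, Perfection.mk_pow_self, hd]
  choose a ha using hsat'
  have hinj : Injective h₀.toRealification := fun b b' hbb' =>
    h₀.factorMap_injective (congrArg Subtype.val hbb' :)
  refine ⟨{ toFun := a, map_one' := hinj (by rw [ha, map_one, map_one]),
             map_mul' := fun x y => hinj (by rw [ha, map_mul, map_mul, ha, ha]) }, ?_, fun x => ha x⟩
  intro x y hxy
  apply hι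
  rw [← ha x, ← ha y]
  exact congrArg h₀.toRealification hxy

/-- **`hQ` for perf-factorial submonoids of `M₀^rlf` with rational support**: if every `M₀^pf_𝔮` is
`ℚ`-monoprime and `S ↪ M₀^rlf` has every element with a power in the image of `M₀`, then every `S^pf_𝔮` is
`ℚ`-monoprime. [cite: MochizukiFrdI2008, Def. 2.4(i) p.47] -/
theorem isQMonoprime_pfAt_of_ratSupport (h₀ : IsPerfFactorial M₀)
    (hQ₀ : ∀ 𝔮 : Primes (Perfection M₀), IsQMonoprime (PfAt M₀ 𝔮)) (hS : IsPerfFactorial S)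
    (ι : S →* h₀.Rlf) (hι : Injective ι)
    (hsat : ∀ x : S, ∃ (N : ℕ+) (d : M₀), ι x ^ (N : ℕ) = h₀.toRealification (Perfection.of M₀ d))
    (𝔮 : Primes (Perfection S)) : IsQMonoprime (PfAt S 𝔮) := by
  obtain ⟨j, hj, -⟩ := exists_embedding_perfection_of_ratSupport h₀ ι hι hsat
  exact isQMonoprime_pfAt_of_embedding_perfection h₀ hQ₀ hS j hj 𝔮

/-- The same from print's form of the hypothesis on `M₀`: every `M₀,𝔭` is a `ℤ`- or a `ℚ`-prime
([EtTh] Remark 3.3.1). [cite: MochizukiEtTh2009, Rmk 3.3.1 p.73] -/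
theorem isQMonoprime_pfAt_of_ratSupport' (h₀ : IsPerfFactorial M₀)
    (hZQ : ∀ 𝔭 : Primes M₀, IsZMonoprime ↥𝔭.submonoid ∨ IsQMonoprime ↥𝔭.submonoid) (hS : IsPerfFactorial S)
    (ι : S →* h₀.Rlf) (hι : Injective ι)
    (hsat : ∀ x : S, ∃ (N : ℕ+) (d : M₀), ι x ^ (N : ℕ) = h₀.toRealification (Perfection.of M₀ d))
    (𝔮 : Primes (Perfection S)) : IsQMonoprime (PfAt S 𝔮) :=
  isQMonoprime_pfAt_of_ratSupport h₀
    (RealifiedDivisorMonoids.Prop34Cnst.isQMonoprime_pfAt_of_forall h₀.isDivisorial.isSharp hZQ) hS ι hι hsat 𝔮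

end HQRatCoord

/-! ### §4 Tempered Frobenioids at the tree vocabulary: `hQ` from `Φ₀(Y)` and the rational support of `Φ(W)` -/

variable {D₀ : Type u₀} [Category.{v₀} D₀] {D : Type u} [Category.{v} D] {VD : FrdICatStub.{u, v, w} D}

namespace TemperedFrobenioid

variable {T' : RealifiedDivisorMonoids (D₀ := D₀) treeMonoidVocab.{w}} {C : TemperedFrobenioid T' D VD}

/-- **`hQ` DERIVED** (tree vocabulary).  If every localized perfection `Φ₀(Y_W)^pf_𝔮₀` is `ℚ`-monoprime and
the divisor monoid `Φ(W) ⊆ Φ^{ℝ-log}(W) = Φ₀^ℝ(Y_W)` has rational support — every `x ∈ Φ(W)` has a power `x^N`,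
`N ≥ 1`, in the image of `Φ₀(Y_W) → Φ₀^ℝ(Y_W)` (Def. 3.6 (i)/(ii) for monoid type `Λ ∈ {ℤ, ℚ}`:
`Φ ⊆ Φ₀^Λ|_D`, `Φ₀^ℤ = Φ₀`, `Φ₀^ℚ = Φ₀^pf`) — then every localized perfection `Φ(W)^pf_𝔮` is `ℚ`-monoprime.
[cite: MochizukiEtTh2009, Def 3.6 p.76] -/
theorem isQMonoprime_pfAt_divisorMonoid_of_ratSupport_of_pfAt (W : D)
    (hQ₀ : ∀ 𝔮₀ : Primes (Perfection (T'.Φ₀.obj (C.baseOp (op W)))),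
      IsQMonoprime (PfAt (T'.Φ₀.obj (C.baseOp (op W))) 𝔮₀))
    (hsat : ∀ x ∈ C.Φ.carrier (op W), ∃ (N : ℕ+) (d : T'.Φ₀.obj (C.baseOp (op W))),
      x ^ (N : ℕ) = T'.toR (C.baseOp (op W)) d)
    (𝔮 : Primes (Perfection (C.divisorMonoid.obj (op W)))) :
    IsQMonoprime (PfAt (C.divisorMonoid.obj (op W)) 𝔮) := by
  obtain ⟨h₀, e, he⟩ := T'.isRealification (C.baseOp (op W))
  let ι : (C.divisorMonoid.obj (op W)) →* h₀.Rlf := e.toMonoidHom.comp (C.Φ.carrier (op W)).subtype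
  have hι : Injective ι := e.injective.comp Subtype.val_injective
  refine HQRatCoord.isQMonoprime_pfAt_of_ratSupport h₀ hQ₀ (isPerfFactorial_divisorMonoid W) ι hι
    (fun x : C.Φ.carrier (op W) => ?_) 𝔮
  obtain ⟨N, d, hd⟩ := hsat (x : T'.ΦR.obj (C.baseOp (op W))) x.2
  refine ⟨N, d, ?_⟩
  change e ((x : T'.ΦR.obj (C.baseOp (op W)))) ^ (N : ℕ) = _
  rw [← map_pow, hd, he]

/-- **`hQ` DERIVED, print's form of the hypothesis on `Φ₀(Y_W)`**: every prime of `Φ₀(Y_W)` is a `ℤ`- or a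
`ℚ`-prime ([EtTh] Remark 3.3.1: `Φ₀(Y)_𝔭 ≅ ℤ_{≥0}`) and `Φ(W)` has rational support in `Φ₀^ℝ(Y_W)`; then every
`Φ(W)^pf_𝔮` is `ℚ`-monoprime — the binder `hQ` of row C38-L05 (G-w4d084-3) at `W`.
[cite: MochizukiEtTh2009, Def 3.6 p.76] -/
theorem isQMonoprime_pfAt_divisorMonoid_of_ratSupport (W : D)
    (hZQ : ∀ 𝔭 : Primes (T'.Φ₀.obj (C.baseOp (op W))),
      IsZMonoprime ↥𝔭.submonoid ∨ IsQMonoprime ↥𝔭.submonoid)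
    (hsat : ∀ x ∈ C.Φ.carrier (op W), ∃ (N : ℕ+) (d : T'.Φ₀.obj (C.baseOp (op W))),
      x ^ (N : ℕ) = T'.toR (C.baseOp (op W)) d)
    (𝔮 : Primes (Perfection (C.divisorMonoid.obj (op W)))) :
    IsQMonoprime (PfAt (C.divisorMonoid.obj (op W)) 𝔮) := by
  obtain ⟨h₀, -, -⟩ := T'.isRealification (C.baseOp (op W))
  exact isQMonoprime_pfAt_divisorMonoid_of_ratSupport_of_pfAt W
    (RealifiedDivisorMonoids.Prop34Cnst.isQMonoprime_pfAt_of_forall h₀.isDivisorial.isSharp hZQ) hsat 𝔮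

/-- **Row C38-L05 at the tree vocabulary with `hQ` REPLACED by data one level down**:
`C.BsFldPreStepLimitCriterion` for THE perfection, given `hF`, `hP34Λ` (typed field of the Def. 3.3 data),
`hNZ` (Def. 3.6 (ii)(b)), (hZQ) every prime of every `Φ₀(Y_W)` is a `ℤ`- or `ℚ`-prime, and (hsat) every `Φ(W)`
has rational support in `Φ₀^ℝ(Y_W)` — `hQ` being a CONSEQUENCE
(`isQMonoprime_pfAt_divisorMonoid_of_ratSupport`). [cite: MochizukiEtTh2009, Cor 3.8 p.81] -/
theorem bsFldPreStepLimitCriterion_of_ratSupport (C : TemperedFrobenioid T' D VD)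
    (hF : PreFrobenioid.IsFrobenioid C.toElem)
    (hP34Λ : ∀ (Y : D₀ᵒᵖ) (b : T'.BΛ.obj Y) (r : T'.ΦR.obj Y),
      T'.divΛ Y b = Algebra.GrothendieckGroup.of r → b ∈ T'.FΛ Y)
    (hNZ : ∀ A : Dᵒᵖ, ∃ u : (T'.BΛ.obj (C.baseOp A) : Type w) × Algebra.GrothendieckGroup (C.Φ.carrier A),
      u ∈ C.cnstFn A ∧ ∃ Z : C.Φ.carrier A, Z ≠ 1 ∧ u.2 = Algebra.GrothendieckGroup.of Z)
    (hZQ : ∀ (W : D) (𝔭 : Primes (T'.Φ₀.obj (C.baseOp (op W)))),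
      IsZMonoprime ↥𝔭.submonoid ∨ IsQMonoprime ↥𝔭.submonoid)
    (hsat : ∀ (W : D), ∀ x ∈ C.Φ.carrier (op W), ∃ (N : ℕ+) (d : T'.Φ₀.obj (C.baseOp (op W))),
      x ^ (N : ℕ) = T'.toR (C.baseOp (op W)) d) :
    C.BsFldPreStepLimitCriterion (PreFrobenioidData.perfection hF) :=
  bsFldPreStepLimitCriterion_of_coord' C hF hP34Λ hNZ
    fun W 𝔮 => isQMonoprime_pfAt_divisorMonoid_of_ratSupport W (hZQ W) (hsat W) 𝔮

end TemperedFrobenioid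

end Literature.AnabelianGeometry.EtaleTheta

end
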